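import Mathlib
import HarnessLib
import Literature.Analysis.ValidatedNumerics.MultiPrecisionInterval
import Literature.Geometry.Riemannian.PinchingEstimatesPreserved

/-!
# Soft four-rings, metric half by certified numerics (1): interval arithmetic for unit vectors

Route `PricedLinkCensus`, sub-problem `Crystallization`, item `SoftFourRings`
(stmt-AtomisticToContinuum-14234).  First file of the certified-numerics proof of the metric half
`LabelledRigidity (6/25)` (`PricedLinkCensusSoftFourRingsDefs`): the kernel of the checker is
fixed-point interval arithmetic at scale `SC = 2^60`, built on the tree's verified engine
`Literature.Analysis.ValidatedNumerics.NumericsMP.MI` (integer endpoints, outward rounding).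
This file adds what the geometric construction needs and proves the inclusion theorems:

* `sqrtI` (outward square root via `Int.sqrt`), `clipUnit` (intersection with `[-1, 1]`),
  the constants `oneI`, `zeroI`, `fracI`;
* interval 3-vectors `IVec` with membership `IVec.mem`, `dotI`, `crossI`, `linI`
  (`λ a + μ b + ν c`), and their inclusion theorems for real vectors `Fin 3 → ℝ`
  (`dotProduct`, `crossProduct`).
-/

namespace Summit.AtomisticToContinuum.Crystallization.Theorems

namespace Rig

open Literature.Analysis.ValidatedNumerics.NumericsMP
open scoped Matrix

/-! ### Scale and scalar helpers -/

/-- The fixed scale of the checker's intervals: `2^60`. -/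
def SC : ℕ := 2 ^ 60

/-- `SC > 0`. -/
theorem SC_pos : 0 < SC := by unfold SC; positivity

/-- The thin interval `1`. -/
def oneI : MI := ⟨SC, SC⟩

/-- The thin interval `0`. -/
def zeroI : MI := ⟨0, 0⟩

/-- An enclosure of the rational `p/q` (`q > 0`). -/
def fracI (p : ℤ) (q : ℕ) : MI := MI.ofFrac SC p q

/-- `1 ∈ oneI`. -/
theorem mem_oneI : MI.mem SC (1 : ℝ) oneI := by
  have := MI.mem_ofInt SC 1
  simpa [oneI, MI.ofInt] using this

/-- `0 ∈ zeroI`. -/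
theorem mem_zeroI : MI.mem SC (0 : ℝ) zeroI := by
  simp [MI.mem, zeroI]

/-- `p/q ∈ fracI p q`. -/
theorem mem_fracI (p : ℤ) {q : ℕ} (hq : 0 < q) : MI.mem SC ((p : ℝ) / q) (fracI p q) :=
  MI.mem_ofFrac SC p hq

/-- Outward square root: for `x ≥ 0` with `x ∈ I`, `√x ∈ sqrtI I`. -/
def sqrtI (I : MI) : MI := ⟨Int.sqrt (max I.lo 0 * SC), Int.sqrt (max I.hi 0 * SC) + 1⟩

/-- `Int.sqrt` of a non-negative integer, squared, is at most the integer (in `ℝ`). -/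
theorem int_sqrt_sq_le {n : ℤ} (hn : 0 ≤ n) : ((Int.sqrt n : ℤ) : ℝ) ^ 2 ≤ n := by
  obtain ⟨m, rfl⟩ := Int.eq_ofNat_of_zero_le hn
  have h := Nat.sqrt_le' m
  rw [Int.sqrt_natCast]
  exact_mod_cast h

/-- A non-negative integer is below the square of `Int.sqrt + 1` (in `ℝ`). -/
theorem lt_int_sqrt_succ_sq {n : ℤ} (hn : 0 ≤ n) : (n : ℝ) < ((Int.sqrt n : ℤ) + 1 : ℝ) ^ 2 := by
  obtain ⟨m, rfl⟩ := Int.eq_ofNat_of_zero_le hn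
  have h := Nat.lt_succ_sqrt' m
  rw [Int.sqrt_natCast]
  exact_mod_cast h

/-- **Inclusion theorem for `sqrtI`.** -/
theorem mem_sqrtI {x : ℝ} {I : MI} (hx : MI.mem SC x I) (h0 : 0 ≤ x) :
    MI.mem SC (Real.sqrt x) (sqrtI I) := by
  have hS : (0 : ℝ) < SC := by exact_mod_cast SC_pos
  obtain ⟨h1, h2⟩ := hx
  have hxS : 0 ≤ x * SC := mul_nonneg h0 hS.le
  have hsq : Real.sqrt x * SC = Real.sqrt (x * SC * SC) := by
    rw [show x * SC * SC = (SC : ℝ) ^ 2 * x by ring, Real.sqrt_mul (by positivity), Real.sqrt_sq hS.le]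
    ring
  constructor
  · -- lower endpoint
    simp only [sqrtI]
    have ha0 : (0 : ℤ) ≤ max I.lo 0 * SC := mul_nonneg (le_max_right _ _) (by exact_mod_cast SC_pos.le)
    have hle : ((max I.lo 0 * SC : ℤ) : ℝ) ≤ x * SC * SC := by
      have hmax : max (I.lo : ℝ) 0 ≤ x * SC := max_le h1 hxS
      push_cast
      nlinarith [hmax, hS]
    have hm0 : (0 : ℝ) ≤ (Int.sqrt (max I.lo 0 * SC) : ℤ) := by exact_mod_cast Int.sqrt_nonneg _
    rw [hsq]
    apply Real.le_sqrt_of_sq_le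
    exact (int_sqrt_sq_le ha0).trans hle
  · simp only [sqrtI]
    have hhi : 0 ≤ I.hi := by
      have : (0 : ℝ) ≤ I.hi := hxS.trans h2
      exact_mod_cast this
    have hb0 : (0 : ℤ) ≤ max I.hi 0 * SC := mul_nonneg (le_max_right _ _) (by exact_mod_cast SC_pos.le)
    have hle : x * SC * SC ≤ ((max I.hi 0 * SC : ℤ) : ℝ) := by
      have hmax : (I.hi : ℝ) ≤ max (I.hi : ℝ) 0 := le_max_left _ _
      push_cast
      nlinarith [hmax, h2, hS]
    rw [hsq]
    push_cast
    apply Real.sqrt_le_iff.2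
    constructor
    · have : (0 : ℝ) ≤ (Int.sqrt (max I.hi 0 * SC) : ℤ) := by exact_mod_cast Int.sqrt_nonneg _
      linarith
    · exact hle.trans (lt_int_sqrt_succ_sq hb0).le

/-- Intersection with `[-1, 1]`. -/
def clipUnit (I : MI) : MI := ⟨max I.lo (-(SC : ℤ)), min I.hi SC⟩

/-- **Inclusion theorem for `clipUnit`**: values in `[-1, 1]` stay in the clipped interval. -/
theorem mem_clipUnit {x : ℝ} {I : MI} (hx : MI.mem SC x I) (h1 : |x| ≤ 1) :
    MI.mem SC x (clipUnit I) := by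
  obtain ⟨ha, hb⟩ := abs_le.1 h1
  have hS : (0 : ℝ) < SC := by exact_mod_cast SC_pos
  constructor
  · simp only [clipUnit]; push_cast
    exact max_le hx.1 (by nlinarith)
  · simp only [clipUnit]; push_cast
    exact le_min hx.2 (by nlinarith)

/-! ### Interval 3-vectors -/

/-- An interval box for a vector of `ℝ³`. -/
structure IVec where
  /-- first coordinate -/
  x : MI
  /-- second coordinate -/
  y : MI
  /-- third coordinate -/
  z : MI
  deriving DecidableEq, Repr, Inhabited

namespace IVec

/-- Coordinate access. -/
def get (V : IVec) : Fin 3 → MI := ![V.x, V.y, V.z]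

/-- First coordinate. -/
@[simp] theorem get_zero (V : IVec) : V.get 0 = V.x := rfl
/-- Second coordinate. -/
@[simp] theorem get_one (V : IVec) : V.get 1 = V.y := rfl
/-- Third coordinate. -/
@[simp] theorem get_two (V : IVec) : V.get 2 = V.z := rfl

/-- Build from coordinates. -/
def ofFn (f : Fin 3 → MI) : IVec := ⟨f 0, f 1, f 2⟩

/-- Coordinates of `ofFn`. -/
@[simp] theorem get_ofFn (f : Fin 3 → MI) (k : Fin 3) : (ofFn f).get k = f k := by
  fin_cases k <;> rfl

/-- Membership of a real vector in a box. -/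
def mem (p : Fin 3 → ℝ) (V : IVec) : Prop := ∀ k, MI.mem SC (p k) (V.get k)

/-- Interval dot product. -/
def dotI (U V : IVec) : MI := ((U.x.mul SC V.x).add (U.y.mul SC V.y)).add (U.z.mul SC V.z)

/-- Interval cross product. -/
def crossI (U V : IVec) : IVec :=
  ⟨(U.y.mul SC V.z).sub (U.z.mul SC V.y), (U.z.mul SC V.x).sub (U.x.mul SC V.z),
    (U.x.mul SC V.y).sub (U.y.mul SC V.x)⟩

/-- The interval combination `λ a + μ b + ν c`. -/
def linI (l m n : MI) (A B C : IVec) : IVec :=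
  ofFn fun k => ((l.mul SC (A.get k)).add (m.mul SC (B.get k))).add (n.mul SC (C.get k))

/-- Coordinatewise intersection with `[-1, 1]`. -/
def clipUnit (V : IVec) : IVec := ofFn fun k => Rig.clipUnit (V.get k)

/-- **Inclusion theorem for `dotI`.** -/
theorem mem_dotI {p q : Fin 3 → ℝ} {U V : IVec} (hp : U.mem p) (hq : V.mem q) :
    MI.mem SC (p ⬝ᵥ q) (dotI U V) := by
  have h : p ⬝ᵥ q = p 0 * q 0 + p 1 * q 1 + p 2 * q 2 := by
    rw [dotProduct, Fin.sum_univ_three]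
  rw [h]
  exact MI.mem_add (MI.mem_add (MI.mem_mul SC_pos (hp 0) (hq 0)) (MI.mem_mul SC_pos (hp 1) (hq 1)))
    (MI.mem_mul SC_pos (hp 2) (hq 2))

/-- **Inclusion theorem for `crossI`.** -/
theorem mem_crossI {p q : Fin 3 → ℝ} {U V : IVec} (hp : U.mem p) (hq : V.mem q) :
    (crossI U V).mem (p ⨯₃ q) := by
  intro k
  rw [cross_apply]
  fin_cases k
  · exact MI.mem_sub (MI.mem_mul SC_pos (hp 1) (hq 2)) (MI.mem_mul SC_pos (hp 2) (hq 1))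
  · exact MI.mem_sub (MI.mem_mul SC_pos (hp 2) (hq 0)) (MI.mem_mul SC_pos (hp 0) (hq 2))
  · exact MI.mem_sub (MI.mem_mul SC_pos (hp 0) (hq 1)) (MI.mem_mul SC_pos (hp 1) (hq 0))

/-- **Inclusion theorem for `linI`.** -/
theorem mem_linI {l m n : ℝ} {L M N : MI} {a b c : Fin 3 → ℝ} {A B C : IVec}
    (hl : MI.mem SC l L) (hm : MI.mem SC m M) (hn : MI.mem SC n N)
    (ha : A.mem a) (hb : B.mem b) (hc : C.mem c) :
    (linI L M N A B C).mem (l • a + m • b + n • c) := by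
  intro k
  simp only [linI, get_ofFn, Pi.add_apply, Pi.smul_apply, smul_eq_mul]
  exact MI.mem_add (MI.mem_add (MI.mem_mul SC_pos hl (ha k)) (MI.mem_mul SC_pos hm (hb k)))
    (MI.mem_mul SC_pos hn (hc k))

/-- **Inclusion theorem for `IVec.clipUnit`** (unit vectors). -/
theorem mem_clipUnit {v : Fin 3 → ℝ} {V : IVec} (hv : V.mem v) (h1 : v ⬝ᵥ v = 1) :
    (clipUnit V).mem v := by
  intro k
  simp only [clipUnit, get_ofFn]
  exact Rig.mem_clipUnit (hv k)
    (Literature.Geometry.Riemannian.HamiltonODE.abs_apply_le_one_of_dot_self h1 k)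

end IVec

end Rig

end Summit.AtomisticToContinuum.Crystallization.Theorems
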